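/-
Copyright (c) 2026 the pub-hodgecm-mathlib formalisation cell (harness21).  Prover seat hodgecm-mathlib-A-p19 (g21), D-T road (Tamagawa ∕ (K7-s)),
brick B1″ part C «D-T3′-def, congruence transport of the top-form Haar measure» (LEAD F0P3a-plan (g9) WORDS T8-1 (B) ∕ T8-16 (D), 2026-09-01).
-/
import Literature.NumberTheory.Weil1964.UnitaryArchTopFormHaarTransport
import HarnessLib

/-!
# The top-form Haar measure of `U(J)(E ⊗ ℝ)` is transported by form congruences: `(T · T⁻¹)_* |Ω_{J₂}| = |Ω_J|` for `σ(T)ᵀ J′ T = J₂′`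
# (Rogawski 1990 §1.7 «compatible measures `dg′ = |ψ^* Ω|`»; Helgason 2000 Ch. I §1 Thm. 1.14; Macdonald 1980)

Topic `NumberTheory/Weil1964`; namespace `Literature.NumberTheory.Weil1964.UnitaryArchTopForm`.  THEOREMS ONLY (no definition, no instance, no notation, no named
fact, no `sorry`).  Cell `pub/hodgecm-mathlib`, crux H413 = `stmt-HodgeConjecture-24833`; D-T road row «D-T3′», brick B1″ part C over ★ B1 `UnitaryArchTopFormHaar`, ★ B1′
`…HaarCM`, ★ B1″ parts A+B `…HaarTransport` (census `CENSUS-B2-ArchSingularCentralizerTopFormHaar` 2aaa130ebe3bf25a §4: the frame independence of the centraliser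
measure `centralizerTopFormHaar` (brick B2) is exactly this transport statement).

THE STATEMENT.  Let `T ∈ GL_N(E ⊗ ℝ)` with `σ(T)ᵀ J′ T = J₂′` (`J′ = archFormOf J`, ★ `formCongr`), so that `g ↦ T g T⁻¹` is the congruence isomorphism
`Φ : U(J₂)(E ⊗ ℝ) ≃ₜ* U(J)(E ⊗ ℝ)` (★ `unitaryGroupOfFormCongrOfEq`).  Then **`Φ_* archTopFormHaar J₂ = archTopFormHaar J`** (`map_archTopFormHaar_of_conj`, for ANY
`Φ` acting by `g ↦ T g T⁻¹`; `map_archCongr_archTopFormHaar` for the tree's term; `…_of_isCM` hypothesis-free in the CM situation).  In print: for an isomorphism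
`ψ` of inner forms the measures `|Ω|` and `|ψ^*Ω|` correspond [Rogawski1990 §1.7 p. 6] — here `ψ = Ad T` and `ψ^* ω_std = ω_std` because `Ad T` has determinant `1` on
`M_N` and preserves the trace form.
THE PROOF.  `Ad T : X ↦ T X T⁻¹` is a linear isomorphism `e : 𝔲(J₂) ≃ 𝔲(J)` (★ `conj_mem_archSkew`) which (i) preserves the trace form (★ `traceForm_conj`), hence
carries the canonical Lebesgue measure `lieStdLebesgue J₂` to `lieStdLebesgue J` (basis independence ★ `lieStdLebesgue_eq_smul_addHaar` + Mathlib
`Module.Basis.map_addHaar`); (ii) conjugates the Jacobian maps `m_Y` (`m_{eY} = e ∘ m_Y ∘ e⁻¹`), hence preserves the Cayley weight `w₀ = |det m_·|⁻¹`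
(`LinearMap.det_conj`); (iii) intertwines the Cayley charts, `Φ (ĉ_{J₂} X) = ĉ_J (e X)` (★ `cayley_conj`).  So `Φ_*` carries the chart measure of the window `V₀` of
`J₂` to the chart measure of the window `e(V₀)` of `J`, and `Φ_* archTopFormHaar J₂` is a Haar measure on `U(J)(E ⊗ ℝ)` satisfying the window identity on `e(V₀)`;
by uniqueness ∕ window independence (★ `eq_archTopFormHaar_of_restrict_eq`) it IS `archTopFormHaar J`.
* §1 `Ad T` on the Lie algebras: `conj_one_add` ∕ `conj_one_sub`, `exists_conjLinearMap`, **`exists_conjEquiv`** (`e : 𝔲(J₂) ≃L[ℝ] 𝔲(J)` with `e X = T X T⁻¹`),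
  `conjEquiv_symm_apply`, `conj_mem_cayleySource`, **`det_skewMulL_conj`**, **`cayleyWeight_conj`**, `lieGram_map_conjEquiv`, `det_lieGram_ne_zero_iff`
  (non-degeneracy is basis-free), `lieGramDet_ne_zero_iff_of_conj`, **`map_conjEquiv_lieStdLebesgue`**.
* §2 the charts and the chart measures: **`conj_cayleyChart`** (`Φ (ĉ X) = ĉ (e X)`), `image_cayleyChart_image_conjEquiv`, **`map_conj_cayleyChartMeasure`**.
* §3 **`map_archTopFormHaar_of_conj`**, **`map_archCongr_archTopFormHaar`**, `map_archCongr_archTopFormHaar_of_isCM`.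
HONEST SCOPE.  Linear algebra and measure transport over ★ B1∕B1′∕B1″∕B5b and Mathlib; no evaluation of any volume.  HC_CM is proved only modulo the printed
citations until rung 0 closes; this file discharges no printed statement — it is the analytic input of brick B2's frame independence.

## References
* J. D. Rogawski, *Automorphic Representations of Unitary Groups in Three Variables*, Ann. of Math. Stud. 123 (1990), §1.7 p. 6 («compatible measures»). [Rogawski1990]
* S. Helgason, *Groups and Geometric Analysis*, AMS Math. Surveys Monogr. 83 (2000), Ch. I §1 Thm. 1.14 p. 96. [Helgason2000]
* I. G. Macdonald, *The volume of a compact Lie group*, Invent. Math. 56 (1980), 93–95. [Macdonald1980]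
* A. W. Knapp, *Lie Groups Beyond an Introduction*, 2nd ed. (2002), I §1, VIII §2. [Knapp2002]
-/

set_option autoImplicit false
-- the scoped normed structure on the submodule `𝔲 ≤ M_N(E ⊗ ℝ)` vs the `[BorelSpace ↥(archSkew …)]` binder's subtype topology (as in ★ B1 ∕ ★ B5b)
set_option backward.isDefEq.respectTransparency false

noncomputable section

open NumberField NumberField.mixedEmbedding NumberField.InfinitePlace Set Filter Topology MeasureTheory MeasureTheory.Measure
open Literature.NumberTheory.Automorphic Literature.NumberTheory.Automorphic.UnitaryGroup
open scoped Classical Matrix Matrix.Norms.Operator MatrixGroups ENNReal NNReal Pointwise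

namespace Literature.NumberTheory.Weil1964

namespace UnitaryArchTopForm

/-! ## §1 `Ad T` on the Lie algebras: the trace form, the Jacobian weight and the canonical Lebesgue measure are transported -/

section Ad

variable (F E : Type) [Field F] [Field E] [NumberField E] [Algebra F E] (c : E ≃ₐ[F] E) (N : ℕ) (J J₂ : Matrix (Fin N) (Fin N) E)

variable {F E c N J J₂}

omit [NumberField E] in
/-- `T (1 + X) T⁻¹ = 1 + T X T⁻¹`. [cite: Knapp2002, I §1] -/
theorem conj_one_add (T : GL (Fin N) (mixedSpace E)) (X : Matrix (Fin N) (Fin N) (mixedSpace E)) :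
    (T : Matrix (Fin N) (Fin N) (mixedSpace E)) * (1 + X) * ((T⁻¹ : GL (Fin N) (mixedSpace E)) : Matrix (Fin N) (Fin N) (mixedSpace E)) =
      1 + (T : Matrix (Fin N) (Fin N) (mixedSpace E)) * X * ((T⁻¹ : GL (Fin N) (mixedSpace E)) : Matrix (Fin N) (Fin N) (mixedSpace E)) := by
  have hTT : (T : Matrix (Fin N) (Fin N) (mixedSpace E)) * ((T⁻¹ : GL (Fin N) (mixedSpace E)) : Matrix (Fin N) (Fin N) (mixedSpace E)) = 1 := by
    rw [← Units.val_mul, mul_inv_cancel, Units.val_one]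
  rw [Matrix.mul_add, Matrix.add_mul, Matrix.mul_one, hTT]

omit [NumberField E] in
/-- `T (1 − X) T⁻¹ = 1 − T X T⁻¹`. [cite: Knapp2002, I §1] -/
theorem conj_one_sub (T : GL (Fin N) (mixedSpace E)) (X : Matrix (Fin N) (Fin N) (mixedSpace E)) :
    (T : Matrix (Fin N) (Fin N) (mixedSpace E)) * (1 - X) * ((T⁻¹ : GL (Fin N) (mixedSpace E)) : Matrix (Fin N) (Fin N) (mixedSpace E)) =
      1 - (T : Matrix (Fin N) (Fin N) (mixedSpace E)) * X * ((T⁻¹ : GL (Fin N) (mixedSpace E)) : Matrix (Fin N) (Fin N) (mixedSpace E)) := by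
  have hTT : (T : Matrix (Fin N) (Fin N) (mixedSpace E)) * ((T⁻¹ : GL (Fin N) (mixedSpace E)) : Matrix (Fin N) (Fin N) (mixedSpace E)) = 1 := by
    rw [← Units.val_mul, mul_inv_cancel, Units.val_one]
  rw [Matrix.mul_sub, Matrix.sub_mul, Matrix.mul_one, hTT]

omit [NumberField E] in
/-- `Ad T` as an `ℝ`-linear map `𝔲(J₂) → 𝔲(J)` when `σ(T)ᵀ J′ T = J₂′` (★ `conj_mem_archSkew`). [cite: Knapp2002, I §1] [cite: Rogawski1990, §1.7 p. 6] -/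
theorem exists_conjLinearMap {T : GL (Fin N) (mixedSpace E)} (h : formCongr (conjMixed F E c) T (archFormOf E N J) = archFormOf E N J₂) :
    ∃ f : archSkew F E c N J₂ →ₗ[ℝ] archSkew F E c N J, ∀ X : archSkew F E c N J₂,
      ((f X : archSkew F E c N J) : Matrix (Fin N) (Fin N) (mixedSpace E)) =
        (T : Matrix (Fin N) (Fin N) (mixedSpace E)) * (X : Matrix (Fin N) (Fin N) (mixedSpace E)) *
          ((T⁻¹ : GL (Fin N) (mixedSpace E)) : Matrix (Fin N) (Fin N) (mixedSpace E)) :=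
  ⟨((LinearMap.mulLeftRight ℝ ((T : Matrix (Fin N) (Fin N) (mixedSpace E)),
        ((T⁻¹ : GL (Fin N) (mixedSpace E)) : Matrix (Fin N) (Fin N) (mixedSpace E)))).comp (archSkew F E c N J₂).subtype).codRestrict
      (archSkew F E c N J) fun X => conj_mem_archSkew h X.2,
    fun _ => rfl⟩

/-- **`Ad T : 𝔲(J₂) ≃L[ℝ] 𝔲(J)`** when `σ(T)ᵀ J′ T = J₂′`: a continuous linear isomorphism `e` with `e X = T X T⁻¹` (inverse `Ad T⁻¹`, ★ `formCongr_inv_formCongr`).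
[cite: Knapp2002, I §1] [cite: Rogawski1990, §1.7 p. 6] -/
theorem exists_conjEquiv {T : GL (Fin N) (mixedSpace E)} (h : formCongr (conjMixed F E c) T (archFormOf E N J) = archFormOf E N J₂) :
    ∃ e : archSkew F E c N J₂ ≃L[ℝ] archSkew F E c N J, ∀ X : archSkew F E c N J₂,
      ((e X : archSkew F E c N J) : Matrix (Fin N) (Fin N) (mixedSpace E)) =
        (T : Matrix (Fin N) (Fin N) (mixedSpace E)) * (X : Matrix (Fin N) (Fin N) (mixedSpace E)) *
          ((T⁻¹ : GL (Fin N) (mixedSpace E)) : Matrix (Fin N) (Fin N) (mixedSpace E)) := by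
  haveI : FiniteDimensional ℝ (Matrix (Fin N) (Fin N) (mixedSpace E)) := finiteDimensional_matrix
  have h' : formCongr (conjMixed F E c) T⁻¹ (archFormOf E N J₂) = archFormOf E N J := by rw [← h, formCongr_inv_formCongr]
  obtain ⟨f, hf⟩ := exists_conjLinearMap (J := J) (J₂ := J₂) h
  obtain ⟨g, hg⟩ := exists_conjLinearMap (J := J₂) (J₂ := J) h'
  simp only [inv_inv] at hg
  have hTT : (T : Matrix (Fin N) (Fin N) (mixedSpace E)) * ((T⁻¹ : GL (Fin N) (mixedSpace E)) : Matrix (Fin N) (Fin N) (mixedSpace E)) = 1 := by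
    rw [← Units.val_mul, mul_inv_cancel, Units.val_one]
  have hTT' : ((T⁻¹ : GL (Fin N) (mixedSpace E)) : Matrix (Fin N) (Fin N) (mixedSpace E)) * (T : Matrix (Fin N) (Fin N) (mixedSpace E)) = 1 := by
    rw [← Units.val_mul, inv_mul_cancel, Units.val_one]
  have h₁ : f ∘ₗ g = LinearMap.id := by
    apply LinearMap.ext
    intro Y
    apply Subtype.ext
    rw [LinearMap.comp_apply, hf, hg, LinearMap.id_apply]
    simp only [Matrix.mul_assoc, hTT, Matrix.mul_one]
    rw [← Matrix.mul_assoc, hTT, Matrix.one_mul]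
  have h₂ : g ∘ₗ f = LinearMap.id := by
    apply LinearMap.ext
    intro X
    apply Subtype.ext
    rw [LinearMap.comp_apply, hg, hf, LinearMap.id_apply]
    simp only [Matrix.mul_assoc, hTT', Matrix.mul_one]
    rw [← Matrix.mul_assoc, hTT', Matrix.one_mul]
  exact ⟨(LinearEquiv.ofLinear f g h₁ h₂).toContinuousLinearEquiv, fun X => hf X⟩

omit [NumberField E] in
/-- The inverse of `Ad T` is `Ad T⁻¹`: `e⁻¹ Y = T⁻¹ Y T`. [cite: Knapp2002, I §1] -/
theorem conjEquiv_symm_apply {T : GL (Fin N) (mixedSpace E)} (e : archSkew F E c N J₂ ≃L[ℝ] archSkew F E c N J)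
    (he : ∀ X : archSkew F E c N J₂, ((e X : archSkew F E c N J) : Matrix (Fin N) (Fin N) (mixedSpace E)) =
      (T : Matrix (Fin N) (Fin N) (mixedSpace E)) * (X : Matrix (Fin N) (Fin N) (mixedSpace E)) * ((T⁻¹ : GL (Fin N) (mixedSpace E)) : Matrix (Fin N) (Fin N) (mixedSpace E)))
    (Y : archSkew F E c N J) :
    ((e.symm Y : archSkew F E c N J₂) : Matrix (Fin N) (Fin N) (mixedSpace E)) =
      ((T⁻¹ : GL (Fin N) (mixedSpace E)) : Matrix (Fin N) (Fin N) (mixedSpace E)) * (Y : Matrix (Fin N) (Fin N) (mixedSpace E)) *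
        (T : Matrix (Fin N) (Fin N) (mixedSpace E)) := by
  have hTT' : ((T⁻¹ : GL (Fin N) (mixedSpace E)) : Matrix (Fin N) (Fin N) (mixedSpace E)) * (T : Matrix (Fin N) (Fin N) (mixedSpace E)) = 1 := by
    rw [← Units.val_mul, inv_mul_cancel, Units.val_one]
  have hY : (Y : Matrix (Fin N) (Fin N) (mixedSpace E)) =
      (T : Matrix (Fin N) (Fin N) (mixedSpace E)) * ((e.symm Y : archSkew F E c N J₂) : Matrix (Fin N) (Fin N) (mixedSpace E)) *
        ((T⁻¹ : GL (Fin N) (mixedSpace E)) : Matrix (Fin N) (Fin N) (mixedSpace E)) := by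
    rw [← he (e.symm Y), e.apply_symm_apply]
  rw [hY]
  simp only [Matrix.mul_assoc, hTT', Matrix.mul_one]
  rw [← Matrix.mul_assoc, hTT', Matrix.one_mul]

omit [NumberField E] in
/-- `Ad T` carries the Cayley source of `𝔲(J₂)` into the Cayley source of `𝔲(J)` (`1 ± T X T⁻¹ = T (1 ± X) T⁻¹`). [cite: Weyl1939, Ch. II §10] -/
theorem conj_mem_cayleySource {T : GL (Fin N) (mixedSpace E)} (e : archSkew F E c N J₂ ≃L[ℝ] archSkew F E c N J)
    (he : ∀ X : archSkew F E c N J₂, ((e X : archSkew F E c N J) : Matrix (Fin N) (Fin N) (mixedSpace E)) =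
      (T : Matrix (Fin N) (Fin N) (mixedSpace E)) * (X : Matrix (Fin N) (Fin N) (mixedSpace E)) * ((T⁻¹ : GL (Fin N) (mixedSpace E)) : Matrix (Fin N) (Fin N) (mixedSpace E)))
    {X : archSkew F E c N J₂} (hX : X ∈ cayleySource F E c N J₂) : e X ∈ cayleySource F E c N J := by
  obtain ⟨u, hu⟩ := hX.1
  obtain ⟨v, hv⟩ := hX.2
  rw [mem_cayleySource_iff, he, ← conj_one_add, ← conj_one_sub, ← hu, ← hv, ← Units.val_mul, ← Units.val_mul, ← Units.val_mul, ← Units.val_mul]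
  exact ⟨Units.isUnit _, Units.isUnit _⟩

/-- **`Ad T` CONJUGATES THE JACOBIAN MAPS**: `det m_{e Y}|_{𝔲(J)} = det m_Y|_{𝔲(J₂)}` (`m_{eY} = e ∘ m_Y ∘ e⁻¹`, Mathlib `LinearMap.det_conj`).
[cite: Helgason2000, Ch. I §1 Thm. 1.14 p. 96] [cite: Weyl1939, Ch. II §10] -/
theorem det_skewMulL_conj {T : GL (Fin N) (mixedSpace E)} (e : archSkew F E c N J₂ ≃L[ℝ] archSkew F E c N J)
    (he : ∀ X : archSkew F E c N J₂, ((e X : archSkew F E c N J) : Matrix (Fin N) (Fin N) (mixedSpace E)) =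
      (T : Matrix (Fin N) (Fin N) (mixedSpace E)) * (X : Matrix (Fin N) (Fin N) (mixedSpace E)) * ((T⁻¹ : GL (Fin N) (mixedSpace E)) : Matrix (Fin N) (Fin N) (mixedSpace E)))
    (Y : archSkew F E c N J₂) :
    (skewMulL F E c N J (e Y)).det = (skewMulL F E c N J₂ Y).det := by
  have key : ((skewMulL F E c N J (e Y) : archSkew F E c N J →L[ℝ] archSkew F E c N J) : archSkew F E c N J →ₗ[ℝ] archSkew F E c N J) =
      (e.toLinearEquiv : archSkew F E c N J₂ →ₗ[ℝ] archSkew F E c N J) ∘ₗ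
        ((skewMulL F E c N J₂ Y : archSkew F E c N J₂ →L[ℝ] archSkew F E c N J₂) : archSkew F E c N J₂ →ₗ[ℝ] archSkew F E c N J₂) ∘ₗ
          (e.toLinearEquiv.symm : archSkew F E c N J →ₗ[ℝ] archSkew F E c N J₂) := by
    apply LinearMap.ext
    intro H
    apply Subtype.ext
    have e1 : ((((skewMulL F E c N J (e Y) : archSkew F E c N J →L[ℝ] archSkew F E c N J) : archSkew F E c N J →ₗ[ℝ] archSkew F E c N J) H :
        archSkew F E c N J) : Matrix (Fin N) (Fin N) (mixedSpace E)) =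
        (1 - ((e Y : archSkew F E c N J) : Matrix (Fin N) (Fin N) (mixedSpace E))) * (H : Matrix (Fin N) (Fin N) (mixedSpace E)) *
          (1 + ((e Y : archSkew F E c N J) : Matrix (Fin N) (Fin N) (mixedSpace E))) := rfl
    have e2 : ((((e.toLinearEquiv : archSkew F E c N J₂ →ₗ[ℝ] archSkew F E c N J) ∘ₗ
        ((skewMulL F E c N J₂ Y : archSkew F E c N J₂ →L[ℝ] archSkew F E c N J₂) : archSkew F E c N J₂ →ₗ[ℝ] archSkew F E c N J₂) ∘ₗ
          (e.toLinearEquiv.symm : archSkew F E c N J →ₗ[ℝ] archSkew F E c N J₂)) H : archSkew F E c N J) : Matrix (Fin N) (Fin N) (mixedSpace E)) =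
        ((e (skewMulL F E c N J₂ Y (e.symm H)) : archSkew F E c N J) : Matrix (Fin N) (Fin N) (mixedSpace E)) := rfl
    rw [e1, e2, he, he, coe_skewMulL_apply, conjEquiv_symm_apply e he H, ← conj_one_add T, ← conj_one_sub T]
    have hTT' : ((T⁻¹ : GL (Fin N) (mixedSpace E)) : Matrix (Fin N) (Fin N) (mixedSpace E)) * (T : Matrix (Fin N) (Fin N) (mixedSpace E)) = 1 := by
      rw [← Units.val_mul, inv_mul_cancel, Units.val_one]
    simp only [Matrix.mul_assoc]
  change LinearMap.det _ = LinearMap.det _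
  rw [key, LinearMap.det_conj]

/-- **THE CAYLEY WEIGHT IS `Ad T`-INVARIANT**: `w₀^{J}(T Y T⁻¹) = w₀^{J₂}(Y)`. [cite: Helgason2000, Ch. I §1 Thm. 1.14 p. 96] [cite: Weyl1939, Ch. II §10] -/
theorem cayleyWeight_conj {T : GL (Fin N) (mixedSpace E)} (e : archSkew F E c N J₂ ≃L[ℝ] archSkew F E c N J)
    (he : ∀ X : archSkew F E c N J₂, ((e X : archSkew F E c N J) : Matrix (Fin N) (Fin N) (mixedSpace E)) =
      (T : Matrix (Fin N) (Fin N) (mixedSpace E)) * (X : Matrix (Fin N) (Fin N) (mixedSpace E)) * ((T⁻¹ : GL (Fin N) (mixedSpace E)) : Matrix (Fin N) (Fin N) (mixedSpace E)))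
    (Y : archSkew F E c N J₂) :
    cayleyWeight F E c N J (e Y) = cayleyWeight F E c N J₂ Y := by
  rw [cayleyWeight_def, cayleyWeight_def, det_skewMulL_conj e he]

/-- **THE GRAM MATRIX IS `Ad T`-INVARIANT**: for a basis `B` of `𝔲(J₂)`, the transported basis `e ∘ B` of `𝔲(J)` has the same Gram matrix for the trace form
(★ `traceForm_conj`). [cite: Macdonald1980, p. 93] -/
theorem lieGram_map_conjEquiv {T : GL (Fin N) (mixedSpace E)} (e : archSkew F E c N J₂ ≃L[ℝ] archSkew F E c N J)
    (he : ∀ X : archSkew F E c N J₂, ((e X : archSkew F E c N J) : Matrix (Fin N) (Fin N) (mixedSpace E)) =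
      (T : Matrix (Fin N) (Fin N) (mixedSpace E)) * (X : Matrix (Fin N) (Fin N) (mixedSpace E)) * ((T⁻¹ : GL (Fin N) (mixedSpace E)) : Matrix (Fin N) (Fin N) (mixedSpace E)))
    {ι : Type} (B : Module.Basis ι ℝ (archSkew F E c N J₂)) :
    lieGram J (B.map e.toLinearEquiv) = lieGram J₂ B := by
  ext i j
  rw [lieGram_apply, lieGram_apply, Module.Basis.map_apply, Module.Basis.map_apply, ContinuousLinearEquiv.coe_toLinearEquiv, he, he, traceForm_conj]

/-- **Non-degeneracy of the trace form is basis-free**: for EVERY finite basis `B` of `𝔲(J)`, `det Gram(B) ≠ 0 ↔ lieGramDet J ≠ 0` (change of basis: the determinant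
acquires the non-zero square `det(P)²`). [cite: Macdonald1980, p. 93] [cite: Knapp2002, VIII §2] -/
theorem det_lieGram_ne_zero_iff {ι : Type} [Fintype ι] (B : Module.Basis ι ℝ (archSkew F E c N J)) :
    (lieGram J B).det ≠ 0 ↔ lieGramDet F E c N J ≠ 0 := by
  haveI : FiniteDimensional ℝ (Matrix (Fin N) (Fin N) (mixedSpace E)) := finiteDimensional_matrix
  set B₀ := lieFinBasis F E c N J with hB₀
  let e : Fin (Module.finrank ℝ (archSkew F E c N J)) ≃ ι := B₀.indexEquiv B
  set B₁ : Module.Basis ι ℝ (archSkew F E c N J) := B₀.reindex e with hB₁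
  have hG : (lieGram J B₁).det = lieGramDet F E c N J := by
    have : lieGram J B₁ = Matrix.reindex e e (lieGram J B₀) := by
      ext i j; simp only [lieGram_apply, hB₁, Module.Basis.reindex_apply, Matrix.reindex_apply, Matrix.submatrix_apply]
    rw [this, Matrix.det_reindex_self]; rfl
  set P := B₁.toMatrix B with hP
  have hGB : (lieGram J B).det = P.det ^ 2 * (lieGram J B₁).det := by
    rw [lieGram_basis_change J B₁ B, Matrix.det_mul, Matrix.det_mul, Matrix.det_transpose]; ring
  have hP0 : P.det ≠ 0 := by rw [hP, ← B₁.det_apply B]; exact (B₁.isUnit_det B).ne_zero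
  rw [hGB, ← hG, mul_ne_zero_iff]
  exact ⟨fun h => h.2, fun h => ⟨pow_ne_zero 2 hP0, h⟩⟩

/-- Under a form congruence the trace forms on `𝔲(J)` and `𝔲(J₂)` are non-degenerate together. [cite: Macdonald1980, p. 93] -/
theorem lieGramDet_ne_zero_iff_of_conj {T : GL (Fin N) (mixedSpace E)} (e : archSkew F E c N J₂ ≃L[ℝ] archSkew F E c N J)
    (he : ∀ X : archSkew F E c N J₂, ((e X : archSkew F E c N J) : Matrix (Fin N) (Fin N) (mixedSpace E)) =
      (T : Matrix (Fin N) (Fin N) (mixedSpace E)) * (X : Matrix (Fin N) (Fin N) (mixedSpace E)) * ((T⁻¹ : GL (Fin N) (mixedSpace E)) : Matrix (Fin N) (Fin N) (mixedSpace E))) :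
    lieGramDet F E c N J ≠ 0 ↔ lieGramDet F E c N J₂ ≠ 0 := by
  have h1 := det_lieGram_ne_zero_iff ((lieFinBasis F E c N J₂).map e.toLinearEquiv)
  have h2 := det_lieGram_ne_zero_iff (lieFinBasis F E c N J₂)
  rw [lieGram_map_conjEquiv e he] at h1
  exact h1.symm.trans h2

variable [MeasurableSpace (archSkew F E c N J)] [BorelSpace (archSkew F E c N J)] [MeasurableSpace (archSkew F E c N J₂)] [BorelSpace (archSkew F E c N J₂)]

/-- **`Ad T` CARRIES THE CANONICAL LEBESGUE MEASURE OF `𝔲(J₂)` TO THAT OF `𝔲(J)`**: `e_* lieStdLebesgue J₂ = lieStdLebesgue J` — `e_*(B.addHaar) = (e ∘ B).addHaar` (Mathlib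
`Module.Basis.map_addHaar`) and the Gram determinant of `e ∘ B` is that of `B`; this is «`(Ad T)^* ω_std = ω_std`». [cite: Macdonald1980, p. 93] [cite: Rogawski1990, §1.7 p. 6] -/
theorem map_conjEquiv_lieStdLebesgue {T : GL (Fin N) (mixedSpace E)} (e : archSkew F E c N J₂ ≃L[ℝ] archSkew F E c N J)
    (he : ∀ X : archSkew F E c N J₂, ((e X : archSkew F E c N J) : Matrix (Fin N) (Fin N) (mixedSpace E)) =
      (T : Matrix (Fin N) (Fin N) (mixedSpace E)) * (X : Matrix (Fin N) (Fin N) (mixedSpace E)) * ((T⁻¹ : GL (Fin N) (mixedSpace E)) : Matrix (Fin N) (Fin N) (mixedSpace E))) :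
    Measure.map e (lieStdLebesgue F E c N J₂) = lieStdLebesgue F E c N J := by
  haveI : FiniteDimensional ℝ (Matrix (Fin N) (Fin N) (mixedSpace E)) := finiteDimensional_matrix
  have h1 : Measure.map e (lieFinBasis F E c N J₂).addHaar = ((lieFinBasis F E c N J₂).map e.toLinearEquiv).addHaar := Module.Basis.map_addHaar _ e
  have h2 := lieStdLebesgue_eq_smul_addHaar J ((lieFinBasis F E c N J₂).map e.toLinearEquiv)
  rw [lieGram_map_conjEquiv e he] at h2
  rw [lieStdLebesgue_def J₂, Measure.map_smul, h1]
  -- `Matrix.det` carries the classical `DecidableEq` instance in ★ B1's basis-generic lemma and `instDecidableEqFin` in `lieStdLebesgue_def`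
  convert h2.symm

end Ad

/-! ## §2 The congruence intertwines the Cayley charts and carries chart measures to chart measures -/

section Chart

variable (F E : Type) [Field F] [Field E] [NumberField E] [Algebra F E] (c : E ≃ₐ[F] E) (N : ℕ) (J J₂ : Matrix (Fin N) (Fin N) E)

variable {F E c N J J₂}

omit [NumberField E] in
/-- **`Φ (ĉ_{J₂} X) = ĉ_J (T X T⁻¹)`** for `Φ = (T · T⁻¹)` and `X` in the source (★ `cayley_conj`). [cite: Weyl1939, Ch. II §10] -/
theorem conj_cayleyChart {T : GL (Fin N) (mixedSpace E)} (Φ : arch F E c N J₂ ≃ₜ* arch F E c N J)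
    (hΦ : ∀ g : arch F E c N J₂, ((Φ g : arch F E c N J) : GL (Fin N) (mixedSpace E)) = T * (g : GL (Fin N) (mixedSpace E)) * T⁻¹)
    (e : archSkew F E c N J₂ ≃L[ℝ] archSkew F E c N J)
    (he : ∀ X : archSkew F E c N J₂, ((e X : archSkew F E c N J) : Matrix (Fin N) (Fin N) (mixedSpace E)) =
      (T : Matrix (Fin N) (Fin N) (mixedSpace E)) * (X : Matrix (Fin N) (Fin N) (mixedSpace E)) * ((T⁻¹ : GL (Fin N) (mixedSpace E)) : Matrix (Fin N) (Fin N) (mixedSpace E)))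
    {X : archSkew F E c N J₂} (hX : X ∈ cayleySource F E c N J₂) :
    Φ (cayleyChart F E c N J₂ X) = cayleyChart F E c N J (e X) := by
  have hX' : e X ∈ cayleySource F E c N J := conj_mem_cayleySource e he hX
  apply Subtype.ext
  apply Units.ext
  rw [hΦ, Units.val_mul, Units.val_mul, coe_cayleyChart J₂ hX, coe_cayleyChart J hX', he, cayley_conj T hX.1]

omit [NumberField E] in
/-- The chart image of a transported window is the `Φ`-image of the chart image: `ĉ_J(e(V)) = Φ(ĉ_{J₂}(V))` for `V ⊆ source`. [cite: Weyl1939, Ch. II §10] -/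
theorem image_cayleyChart_image_conjEquiv {T : GL (Fin N) (mixedSpace E)} (Φ : arch F E c N J₂ ≃ₜ* arch F E c N J)
    (hΦ : ∀ g : arch F E c N J₂, ((Φ g : arch F E c N J) : GL (Fin N) (mixedSpace E)) = T * (g : GL (Fin N) (mixedSpace E)) * T⁻¹)
    (e : archSkew F E c N J₂ ≃L[ℝ] archSkew F E c N J)
    (he : ∀ X : archSkew F E c N J₂, ((e X : archSkew F E c N J) : Matrix (Fin N) (Fin N) (mixedSpace E)) =
      (T : Matrix (Fin N) (Fin N) (mixedSpace E)) * (X : Matrix (Fin N) (Fin N) (mixedSpace E)) * ((T⁻¹ : GL (Fin N) (mixedSpace E)) : Matrix (Fin N) (Fin N) (mixedSpace E)))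
    {V : Set (archSkew F E c N J₂)} (hV : V ⊆ cayleySource F E c N J₂) :
    cayleyChart F E c N J '' (e '' V) = Φ '' (cayleyChart F E c N J₂ '' V) := by
  rw [Set.image_image, Set.image_image]
  exact Set.image_congr fun X hX => (conj_cayleyChart Φ hΦ e he (hV hX)).symm

variable [MeasurableSpace (archSkew F E c N J)] [BorelSpace (archSkew F E c N J)] [MeasurableSpace (arch F E c N J)] [BorelSpace (arch F E c N J)]
variable [MeasurableSpace (archSkew F E c N J₂)] [BorelSpace (archSkew F E c N J₂)] [MeasurableSpace (arch F E c N J₂)] [BorelSpace (arch F E c N J₂)]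

/-- `withDensity` transported along a measurable equivalence: `e_*(μ · f) = (e_* μ) · (f ∘ e⁻¹)`. [folklore] -/
private theorem map_withDensity_equiv {α β : Type*} [MeasurableSpace α] [MeasurableSpace β] (μ : Measure α) (em : α ≃ᵐ β) (f : α → ℝ≥0∞) :
    (μ.withDensity f).map em = (μ.map em).withDensity (f ∘ em.symm) := by
  ext s hs
  rw [Measure.map_apply em.measurable hs, withDensity_apply _ (em.measurable hs), withDensity_apply _ hs, em.restrict_map, lintegral_map_equiv]
  simp only [Function.comp_apply, em.symm_apply_apply]

/-- **`Φ_*` CARRIES CHART MEASURES TO CHART MEASURES**: `Φ_* (ĉ_{J₂})_*(w₀ · lieStdLebesgue J₂|_V) = (ĉ_J)_*(w₀ · lieStdLebesgue J|_{e(V)})` for `V ⊆ source`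
measurable — charts intertwined (`conj_cayleyChart`), weight invariant (`cayleyWeight_conj`), Lebesgue measure transported (`map_conjEquiv_lieStdLebesgue`).
[cite: Helgason2000, Ch. I §1 Thm. 1.14 p. 96] [cite: Rogawski1990, §1.7 p. 6] -/
theorem map_conj_cayleyChartMeasure {T : GL (Fin N) (mixedSpace E)} (Φ : arch F E c N J₂ ≃ₜ* arch F E c N J)
    (hΦ : ∀ g : arch F E c N J₂, ((Φ g : arch F E c N J) : GL (Fin N) (mixedSpace E)) = T * (g : GL (Fin N) (mixedSpace E)) * T⁻¹)
    (e : archSkew F E c N J₂ ≃L[ℝ] archSkew F E c N J)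
    (he : ∀ X : archSkew F E c N J₂, ((e X : archSkew F E c N J) : Matrix (Fin N) (Fin N) (mixedSpace E)) =
      (T : Matrix (Fin N) (Fin N) (mixedSpace E)) * (X : Matrix (Fin N) (Fin N) (mixedSpace E)) * ((T⁻¹ : GL (Fin N) (mixedSpace E)) : Matrix (Fin N) (Fin N) (mixedSpace E)))
    {V : Set (archSkew F E c N J₂)} (hVs : V ⊆ cayleySource F E c N J₂) (hVm : MeasurableSet V) :
    Measure.map Φ (cayleyChartMeasure F E c N J₂ (lieStdLebesgue F E c N J₂) V) = cayleyChartMeasure F E c N J (lieStdLebesgue F E c N J) (e '' V) := by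
  set em : archSkew F E c N J₂ ≃ᵐ archSkew F E c N J := e.toHomeomorph.toMeasurableEquiv with hem_def
  have hem : (⇑em : archSkew F E c N J₂ → archSkew F E c N J) = ⇑e := rfl
  have hems : ∀ Y, em.symm Y = e.symm Y := fun _ => rfl
  set ρ₂ := ((lieStdLebesgue F E c N J₂).restrict V).withDensity fun X => ENNReal.ofReal (cayleyWeight F E c N J₂ X) with hρ₂
  -- `Φ ∘ ĉ₂ = ĉ ∘ e` almost everywhere for `ρ₂` (i.e. on `V`)
  have hae : (⇑Φ ∘ cayleyChart F E c N J₂) =ᵐ[ρ₂] (cayleyChart F E c N J ∘ ⇑e) := by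
    have h1 : ∀ᵐ X ∂ρ₂, X ∈ V := (withDensity_absolutelyContinuous _ _).ae_le (ae_restrict_mem hVm)
    filter_upwards [h1] with X hX
    exact conj_cayleyChart Φ hΦ e he (hVs hX)
  have hΦmeas : Measurable (⇑Φ : arch F E c N J₂ → arch F E c N J) := Φ.continuous.measurable
  have hemeas : Measurable (⇑e : archSkew F E c N J₂ → archSkew F E c N J) := e.continuous.measurable
  rw [cayleyChartMeasure, cayleyChartMeasure, ← hρ₂, Measure.map_map hΦmeas (measurable_cayleyChart J₂), Measure.map_congr hae,
    ← Measure.map_map (measurable_cayleyChart J) hemeas]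
  congr 1
  -- the measure on `𝔲(J)`: `e_* ρ₂ = (lieStdLebesgue J|_{e V}) · w₀`
  have hres : Measure.map em ((lieStdLebesgue F E c N J₂).restrict V) = (lieStdLebesgue F E c N J).restrict (e '' V) := by
    rw [← map_conjEquiv_lieStdLebesgue (J := J) (J₂ := J₂) e he, ← hem, em.restrict_map, em.injective.preimage_image]
  rw [hρ₂, ← hem, map_withDensity_equiv _ em, hres, hem]
  congr 1
  funext Y
  rw [Function.comp_apply, hems, ← cayleyWeight_conj (J := J) e he (e.symm Y), e.apply_symm_apply]

end Chart

/-! ## §3 The transport theorem -/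

section Transport

variable (F E : Type) [Field F] [Field E] [NumberField E] [Algebra F E] (c : E ≃ₐ[F] E) (N : ℕ) (J J₂ : Matrix (Fin N) (Fin N) E)

variable {F E c N J J₂}

variable [MeasurableSpace (archSkew F E c N J)] [BorelSpace (archSkew F E c N J)] [MeasurableSpace (arch F E c N J)] [BorelSpace (arch F E c N J)]
variable [MeasurableSpace (archSkew F E c N J₂)] [BorelSpace (archSkew F E c N J₂)] [MeasurableSpace (arch F E c N J₂)] [BorelSpace (arch F E c N J₂)]

/-- **CONGRUENCE TRANSPORT OF THE TOP-FORM HAAR MEASURE.**  Let `σ(T)ᵀ J′ T = J₂′` and let `Φ : U(J₂)(E ⊗ ℝ) ≃ₜ* U(J)(E ⊗ ℝ)` act by `g ↦ T g T⁻¹`.  Then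
`Φ_* archTopFormHaar J₂ = archTopFormHaar J` (the trace form on `𝔲(J)` non-degenerate): `Φ_* |Ω_{J₂}| = |Ω_J|`, print's correspondence of the measures `|Ω|`, `|ψ^*Ω|` under
an isomorphism of inner forms.  Proof: `Φ_* archTopFormHaar J₂` is a Haar measure satisfying the window identity on the transported window `e(V₀)`
(`map_conj_cayleyChartMeasure`), hence equals `archTopFormHaar J` by ★ `eq_archTopFormHaar_of_restrict_eq`.
[cite: Rogawski1990, §1.7 p. 6] [cite: Helgason2000, Ch. I §1 Thm. 1.14 p. 96] [cite: Macdonald1980, p. 93] -/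
theorem map_archTopFormHaar_of_conj (hnd : lieGramDet F E c N J ≠ 0) {T : GL (Fin N) (mixedSpace E)}
    (h : formCongr (conjMixed F E c) T (archFormOf E N J) = archFormOf E N J₂) (Φ : arch F E c N J₂ ≃ₜ* arch F E c N J)
    (hΦ : ∀ g : arch F E c N J₂, ((Φ g : arch F E c N J) : GL (Fin N) (mixedSpace E)) = T * (g : GL (Fin N) (mixedSpace E)) * T⁻¹) :
    Measure.map Φ (archTopFormHaar F E c N J₂) = archTopFormHaar F E c N J := by
  haveI : FiniteDimensional ℝ (Matrix (Fin N) (Fin N) (mixedSpace E)) := finiteDimensional_matrix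
  obtain ⟨e, he⟩ := exists_conjEquiv (J := J) (J₂ := J₂) h
  have hnd₂ : lieGramDet F E c N J₂ ≠ 0 := (lieGramDet_ne_zero_iff_of_conj e he).1 hnd
  haveI := isHaarMeasure_archTopFormHaar J₂ hnd₂
  haveI : (Measure.map Φ (archTopFormHaar F E c N J₂)).IsHaarMeasure := ContinuousMulEquiv.isHaarMeasure_map _ Φ
  -- the transported window
  have hVo : IsOpen (e '' window F E c N J₂) := e.toHomeomorph.isOpenMap _ (isOpen_window J₂)
  have h0 : (0 : archSkew F E c N J) ∈ e '' window F E c N J₂ := ⟨0, zero_mem_window J₂, map_zero e⟩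
  have hVs : e '' window F E c N J₂ ⊆ cayleySource F E c N J := by
    rintro _ ⟨X, hX, rfl⟩
    exact conj_mem_cayleySource e he (window_subset_cayleySource J₂ hX)
  refine eq_archTopFormHaar_of_restrict_eq J hnd _ hVo h0 hVs ?_
  -- the window identity on `ĉ_J(e(V₀)) = Φ(ĉ_{J₂}(V₀))`
  set Φm : arch F E c N J₂ ≃ᵐ arch F E c N J := Φ.toHomeomorph.toMeasurableEquiv with hΦm_def
  have hΦm : (⇑Φm : arch F E c N J₂ → arch F E c N J) = ⇑Φ := rfl
  have hpre : ⇑Φm ⁻¹' (⇑Φm '' (cayleyChart F E c N J₂ '' window F E c N J₂)) = cayleyChart F E c N J₂ '' window F E c N J₂ :=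
    Φm.injective.preimage_image _
  rw [image_cayleyChart_image_conjEquiv Φ hΦ e he (window_subset_cayleySource J₂), ← hΦm, Φm.restrict_map, hpre, archTopFormHaar_restrict_window J₂ hnd₂, hΦm]
  exact map_conj_cayleyChartMeasure Φ hΦ e he (window_subset_cayleySource J₂) (isOpen_window J₂).measurableSet

/-- **THE TREE'S CONGRUENCE ISO** ★ `unitaryGroupOfFormCongrOfEq (conjMixed F E c) T (archFormOf J) (archFormOf J₂) h : U(J₂)(E ⊗ ℝ) ≃ₜ* U(J)(E ⊗ ℝ)` (`g ↦ T g T⁻¹`)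
carries `archTopFormHaar J₂` to `archTopFormHaar J`. [cite: Rogawski1990, §1.7 p. 6] [cite: Helgason2000, Ch. I §1 Thm. 1.14 p. 96] -/
theorem map_archCongr_archTopFormHaar (hnd : lieGramDet F E c N J ≠ 0) {T : GL (Fin N) (mixedSpace E)}
    (h : formCongr (conjMixed F E c) T (archFormOf E N J) = archFormOf E N J₂) :
    Measure.map (α := arch F E c N J₂) (β := arch F E c N J) (unitaryGroupOfFormCongrOfEq (conjMixed F E c) T (archFormOf E N J) (archFormOf E N J₂) h)
        (archTopFormHaar F E c N J₂) = archTopFormHaar F E c N J :=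
  map_archTopFormHaar_of_conj hnd h _ fun _ => rfl

/-- The CM situation (`c ≠ 1` fixing every infinite place, `J` `c`-hermitian with `det J ≠ 0`): the congruence iso carries `archTopFormHaar J₂` to `archTopFormHaar J` with
no hypothesis left (★ B1′ `lieGramDet_ne_zero`). [cite: Rogawski1990, §1.7 p. 6] -/
theorem map_archCongr_archTopFormHaar_of_isCM (hc : c ≠ 1) (hfix : ∀ w : InfinitePlace E, c • w = w) (hherm : (J.map c)ᵀ = J) (hJ : IsUnit J.det)
    {T : GL (Fin N) (mixedSpace E)} (h : formCongr (conjMixed F E c) T (archFormOf E N J) = archFormOf E N J₂) :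
    Measure.map (α := arch F E c N J₂) (β := arch F E c N J) (unitaryGroupOfFormCongrOfEq (conjMixed F E c) T (archFormOf E N J) (archFormOf E N J₂) h)
        (archTopFormHaar F E c N J₂) = archTopFormHaar F E c N J :=
  map_archCongr_archTopFormHaar (lieGramDet_ne_zero J hc hfix hherm hJ) h

end Transport

end UnitaryArchTopForm

end Literature.NumberTheory.Weil1964

end
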